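import Summits.Parity.GeneralizedHardyLittlewood.Theses.DicksonFibration
import Summits.Parity.GeneralizedHardyLittlewood.Theorems.DicksonFibrationDimOneStubSieveCount
import Summits.Parity.GeneralizedHardyLittlewood.Theorems.DicksonFibrationDimOneStubSingularTail
import Summits.Parity.GeneralizedHardyLittlewood.Theorems.DicksonFibrationDimOneStubPrimeClassSums
import Summits.Parity.GeneralizedHardyLittlewood.Theorems.DicksonFibrationDimOneStubPrimeSieve
import Summits.Parity.GeneralizedHardyLittlewood.Theorems.LeeYangFibresAbsoluteUpgradeSinglesDecayDict
import Literature.NumberTheory.Sieve.LinearEquationsInPrimesDimOne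
import Literature.NumberTheory.Sieve.LinearEquationsInPrimesSingularSeries
import HarnessLib

/-!
# Route `DicksonFibration`, crux `DimOne` (stmt-Parity-0819), line `birth` (sieve model): the crux is
# EXACTLY the two-rough-factor statement — `TwoFlatFactors ↔ DimOne`

Lead `prover-line-stmt-Parity-0819-c2-0`, 2026-08-17. With the four provable stubs of the reshaped skeleton
`Cruxes/DimOne/Lines/birth.lean` now THEOREMS of the tree —
`stub_sieveCount` (Fundamental Lemma on the values of `∏ ψ_k`, `…StubSieveCount.lean`),
`stub_singularTail` (uniform tail of `∏_p β_p` at the sieve level, `…StubSingularTail.lean`),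
`stub_primeClassSums` (Bombieri–Vinogradov class sums of `Λ` along a form, `…StubPrimeClassSums.lean`),
`stub_primeSieve` (one prime among `t − 1` sifted forms, `…StubPrimeSieve.lean`) — this file proves the
sorry-free part of the skeleton and records the resulting EXACT REDUCTION of the crux:

* `exists_posInterval`, `corrTerm_eq_sum_Icc`, `corrTerm_empty_eq`, `corrTerm_singleton_eq` — the mixed
  correlations `C_T = corrTerm T Ψ K N` of the splitting `Λ = Λ♯_N + Λ♭_N` (sieve model
  `Λ♯_N = 1[·>0] Λ_{ℤ/P_N}`, vocabulary `…DicksonFibrationDimOneDefs.lean`) are sums over the integer interval of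
  positive lattice points of `K`; `C_∅` is a sifted count and `C_{{i}}` a one-prime sifted sum minus `C_∅`;
* `sharpMainTerm : SharpMainTerm` — **S♯ holds**: `|C_∅ − archFactor · singularProduct| ≤ εN` uniformly
  (the constant of Dickson–Hardy–Littlewood, shift-uniform, is produced by the sieve model);
* `oneFlatFactor : OneFlatFactor` — **S1 holds**: `|C_{{i}}| ≤ εN` uniformly;
* `vonMangoldtSum_eq_sum_corrTerm`, `sum_powerset_split`, `dimOne_of_three` — the multilinear expansion and
  the three-piece composition (as in the registrar's skeleton);
* `dimOne_of_twoFlatFactors : TwoFlatFactors → DimOne`, `twoFlatFactors_of_dimOne : DimOne → TwoFlatFactors`,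
  **`twoFlatFactors_iff_dimOne : TwoFlatFactors ↔ DimOne`** — the crux (Green–Tao Conj. 1.2 at `d = 1`,
  shift-uniform Dickson–Hardy–Littlewood) is EQUIVALENT to the constant-free statement that the correlations
  with at least two rough factors `Λ♭_N = Λ − Λ♯_N` are `o(N)`: at `t = 2`, `(n, n + 2)` this reads
  `Σ_{n ≤ N} Λ♭_N(n) Λ♭_N(n+2) = o(N)`. Zero slack: what remains of the crux is exactly its parity-sensitive
  heart (registered stub `stub_twoFlatFactors`, open), on which every catalogued binary barrier bites.

References: B. Green, T. Tao, Ann. of Math. 171 (2010), Conj. 1.2, (1.5), §12 (12.3) [GreenTao2010];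
H. Halberstam, H.-E. Richert, *Sieve Methods* (1974), Thm. 2.5 [HalberstamRichert1974].
-/

noncomputable section

namespace Summit.Parity.GeneralizedHardyLittlewood.Cruxes.DimOne.BirthSieve

open scoped BigOperators Classical
open Finset Filter MeasureTheory Literature.NumberTheory.Sieve
open Summit.Parity.GeneralizedHardyLittlewood.Theses.DicksonFibration (DimOne)

/-! ## The interval of positive lattice points -/

variable {t : ℕ}

/-- **The positive lattice points of `K` form an integer interval `I` with `|#I − β_∞| ≤ 1`.** For a convex
`K ⊆ [-N, N]` there are `m₁, m₂` with `{m ∈ [-N, N] : (m) ∈ K, ψ_k(m) ≥ 1 ∀ k} = [m₁, m₂]` and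
`|#[m₁, m₂] − archFactor Ψ K| ≤ 1` (tree: `DimOne.exists_filter_eq_Icc`, `DimOne.archFactor_eq`).
[cite: GreenTao2010, (1.4) and App. A] -/
theorem exists_posInterval (Ψ : Fin t → AffLinForm 1) {N : ℕ} {K : Set (Fin 1 → ℝ)} (hK : Convex ℝ K)
    (hKN : K ⊆ realBox 1 N) :
    ∃ m₁ m₂ : ℤ, (∀ m : ℤ, m ∈ Finset.Icc m₁ m₂ ↔
        (m ∈ Finset.Icc (-(N : ℤ)) N ∧ (fun _ : Fin 1 => (m : ℝ)) ∈ K ∧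
          ∀ k, 1 ≤ (Ψ k).eval (fun _ => m))) ∧
      |(#(Finset.Icc m₁ m₂) : ℝ) - archFactor Ψ K| ≤ 1 := by
  classical
  -- adapted from `Theorems.AbsoluteUpgrade.exists_interval` (keeping the two-sided volume bound)
  set S : Set ℝ := {r : ℝ | (fun _ : Fin 1 => r) ∈ K ∧ ∀ i, 0 < (Ψ i).realEval (fun _ => r)} with hS
  have harch : archFactor Ψ K = (volume S).toReal := DimOne.archFactor_eq Ψ K
  have hSconv : Convex ℝ S := by
    have h1 : Convex ℝ {r : ℝ | (fun _ : Fin 1 => r) ∈ K} := DimOne.convex_slice hK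
    have h2 : ∀ i, Convex ℝ {r : ℝ | 0 < (Ψ i).realEval (fun _ => r)} := fun i => by
      have : {r : ℝ | 0 < (Ψ i).realEval (fun _ => r)} =
          {r : ℝ | 0 < ((Ψ i).coeff 0 : ℝ) * r + (Ψ i).const} := by
        ext r; simp [DimOne.realEval_eq]
      rw [this]; exact DimOne.convex_setOf_pos _ _
    have : S = {r : ℝ | (fun _ : Fin 1 => r) ∈ K} ∩ ⋂ i, {r : ℝ | 0 < (Ψ i).realEval (fun _ => r)} := by
      ext r; simp [hS]
    rw [this]
    exact h1.inter (convex_iInter h2)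
  have hSN : S ⊆ Set.Icc (-(N : ℝ)) N := by
    intro r hr
    have h := hKN hr.1
    simp only [realBox, Set.mem_Icc, Pi.le_def] at h
    exact ⟨h.1 0, h.2 0⟩
  obtain ⟨m₁, m₂, hI, hvol⟩ := DimOne.exists_filter_eq_Icc (N := N) hSconv.ordConnected hSN
  refine ⟨m₁, m₂, fun m => ?_, ?_⟩
  · rw [← hI, Finset.mem_filter]
    simp only [hS, Set.mem_setOf_eq]
    have hev : ∀ k, (Ψ k).realEval (fun _ : Fin 1 => (m : ℝ)) = (((Ψ k).eval (fun _ => m) : ℤ) : ℝ) :=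
      fun k => (Ψ k).realEval_intCast (fun _ => m)
    simp only [hev]
    constructor
    · rintro ⟨hm, hK', hpos⟩
      exact ⟨hm, hK', fun k => by have := hpos k; exact_mod_cast this⟩
    · rintro ⟨hm, hK', hpos⟩
      exact ⟨hm, hK', fun k => by have := hpos k; exact_mod_cast this⟩
  · rw [harch]
    exact hvol

/-- The interval of `exists_posInterval` is a positive interval in the sense of `IsPosInterval`. [folklore] -/
theorem isPosInterval_of_iff (Ψ : Fin t → AffLinForm 1) {N : ℕ} {K : Set (Fin 1 → ℝ)} {m₁ m₂ : ℤ}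
    (hI : ∀ m : ℤ, m ∈ Finset.Icc m₁ m₂ ↔
        (m ∈ Finset.Icc (-(N : ℤ)) N ∧ (fun _ : Fin 1 => (m : ℝ)) ∈ K ∧
          ∀ k, 1 ≤ (Ψ k).eval (fun _ => m))) :
    IsPosInterval Ψ N m₁ m₂ := fun m hm =>
  ⟨((hI m).mp hm).1, ((hI m).mp hm).2.2⟩

/-- `#I ≤ 2N + 1` for an integer interval `I ⊆ [-N, N]`. [folklore] -/
theorem card_Icc_le_of_isPosInterval (Ψ : Fin t → AffLinForm 1) {N : ℕ} {m₁ m₂ : ℤ}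
    (h : IsPosInterval Ψ N m₁ m₂) : (#(Finset.Icc m₁ m₂) : ℝ) ≤ 2 * N + 1 := by
  have hsub : Finset.Icc m₁ m₂ ⊆ Finset.Icc (-(N : ℤ)) N := fun m hm => (h m hm).1
  have h1 := Finset.card_le_card hsub
  have h2 : #(Finset.Icc (-(N : ℤ)) N) = 2 * N + 1 := by
    rw [Int.card_Icc]; omega
  rw [h2] at h1
  exact_mod_cast h1

/-! ## The correlation terms as sums over the interval -/

/-- **Every `corrTerm T` is a sum over the interval of positive lattice points** (off it some form is
`≤ 0`, where both `Λ♭_N` and `Λ♯_N` vanish). [folklore] -/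
theorem corrTerm_eq_sum_Icc (T : Finset (Fin t)) (Ψ : Fin t → AffLinForm 1) {N : ℕ}
    {K : Set (Fin 1 → ℝ)} {m₁ m₂ : ℤ}
    (hI : ∀ m : ℤ, m ∈ Finset.Icc m₁ m₂ ↔
        (m ∈ Finset.Icc (-(N : ℤ)) N ∧ (fun _ : Fin 1 => (m : ℝ)) ∈ K ∧
          ∀ k, 1 ≤ (Ψ k).eval (fun _ => m))) :
    corrTerm T Ψ K N =
      ∑ m ∈ Finset.Icc m₁ m₂, (∏ i ∈ T, flatZ N ((Ψ i).eval (fun _ => m))) *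
        ∏ i ∈ univ \ T, sharpZ N ((Ψ i).eval (fun _ => m)) := by
  classical
  unfold corrTerm
  rw [Summit.Parity.GeneralizedHardyLittlewood.Theorems.AbsoluteUpgrade.sum_filter_latticeBox]
  symm
  refine Finset.sum_subset (fun m hm => ?_) (fun m hm hmn => ?_)
  · rw [Finset.mem_filter]
    obtain ⟨h1, h2, -⟩ := (hI m).mp hm
    exact ⟨h1, h2⟩
  · -- some form is `≤ 0` at `m`
    rw [Finset.mem_filter] at hm
    have hnot : ¬ ∀ k, 1 ≤ (Ψ k).eval (fun _ => m) := fun h => hmn ((hI m).mpr ⟨hm.1, hm.2, h⟩)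
    push Not at hnot
    obtain ⟨k, hk⟩ := hnot
    have hk0 : (Ψ k).eval (fun _ => m) ≤ 0 := by omega
    by_cases hkT : k ∈ T
    · rw [Finset.prod_eq_zero hkT (flatZ_of_nonpos N hk0), zero_mul]
    · rw [Finset.prod_eq_zero (Finset.mem_sdiff.mpr ⟨Finset.mem_univ k, hkT⟩) (sharpZ_of_nonpos N hk0),
        mul_zero]

/-- A product of sieve-model factors over positive values is `(P/φ(P))^{#S}` if all values are coprime
to `P`, and `0` otherwise. [cite: GreenTao2010, (1.5)] -/
theorem prod_sharpZ_eq (S : Finset (Fin t)) (Ψ : Fin t → AffLinForm 1) {N : ℕ} {m : ℤ}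
    (hpos : ∀ k, 1 ≤ (Ψ k).eval (fun _ => m)) :
    ∏ i ∈ S, sharpZ N ((Ψ i).eval (fun _ => m)) =
      if ∀ i ∈ S, Int.gcd ((Ψ i).eval (fun _ => m)) (sieveModulus N) = 1 then
        sieveWeight N ^ S.card else 0 := by
  classical
  have h1 : ∀ i ∈ S, sharpZ N ((Ψ i).eval (fun _ => m)) =
      if Int.gcd ((Ψ i).eval (fun _ => m)) (sieveModulus N) = 1 then sieveWeight N else 0 := by
    intro i _
    rw [sharpZ_eq]
    have hp : 0 < (Ψ i).eval (fun _ => m) := by have := hpos i; omega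
    by_cases hg : Int.gcd ((Ψ i).eval (fun _ => m)) (sieveModulus N) = 1
    · rw [if_pos ⟨hp, hg⟩, if_pos hg]
    · rw [if_neg (fun h => hg h.2), if_neg hg]
  rw [Finset.prod_congr rfl h1, Finset.prod_ite_zero, Finset.prod_const]
  by_cases h : ∀ i ∈ S, Int.gcd ((Ψ i).eval (fun _ => m)) (sieveModulus N) = 1
  · rw [if_pos h, if_pos h]
  · rw [if_neg h, if_neg h]

/-- **`corrTerm ∅` is a sifted count**: `C_∅ = (P/φ(P))^t · #{m ∈ I : (ψ_k(m), P) = 1 ∀ k}`. [folklore] -/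
theorem corrTerm_empty_eq (Ψ : Fin t → AffLinForm 1) {N : ℕ} {K : Set (Fin 1 → ℝ)} {m₁ m₂ : ℤ}
    (hI : ∀ m : ℤ, m ∈ Finset.Icc m₁ m₂ ↔
        (m ∈ Finset.Icc (-(N : ℤ)) N ∧ (fun _ : Fin 1 => (m : ℝ)) ∈ K ∧
          ∀ k, 1 ≤ (Ψ k).eval (fun _ => m))) :
    corrTerm ∅ Ψ K N = sieveWeight N ^ t *
      (#((Finset.Icc m₁ m₂).filter (fun m : ℤ =>
          ∀ k, Int.gcd ((Ψ k).eval (fun _ => m)) (sieveModulus N) = 1)) : ℝ) := by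
  classical
  rw [corrTerm_eq_sum_Icc ∅ Ψ hI]
  simp only [Finset.prod_empty, one_mul, Finset.sdiff_empty]
  have h1 : ∀ m ∈ Finset.Icc m₁ m₂, ∏ i ∈ (univ : Finset (Fin t)), sharpZ N ((Ψ i).eval (fun _ => m)) =
      if ∀ k, Int.gcd ((Ψ k).eval (fun _ => m)) (sieveModulus N) = 1 then sieveWeight N ^ t else 0 := by
    intro m hm
    rw [prod_sharpZ_eq univ Ψ ((hI m).mp hm).2.2, Finset.card_univ, Fintype.card_fin]
    simp only [Finset.mem_univ, forall_true_left]
  rw [Finset.sum_congr rfl h1, ← Finset.sum_filter, Finset.sum_const, nsmul_eq_mul, mul_comm]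

/-- **`corrTerm {i}` is a one-prime sifted sum minus `corrTerm ∅`**:
`C_{{i}} = (P/φ(P))^{t−1} Σ_{m ∈ I : (ψ_k(m), P) = 1 ∀ k ≠ i} Λ(ψ_i(m)) − C_∅`. [folklore] -/
theorem corrTerm_singleton_eq (Ψ : Fin t → AffLinForm 1) {N : ℕ} {K : Set (Fin 1 → ℝ)} {m₁ m₂ : ℤ}
    (hI : ∀ m : ℤ, m ∈ Finset.Icc m₁ m₂ ↔
        (m ∈ Finset.Icc (-(N : ℤ)) N ∧ (fun _ : Fin 1 => (m : ℝ)) ∈ K ∧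
          ∀ k, 1 ≤ (Ψ k).eval (fun _ => m))) (i : Fin t) :
    corrTerm {i} Ψ K N = sieveWeight N ^ (t - 1) *
      (∑ m ∈ (Finset.Icc m₁ m₂).filter (fun m : ℤ =>
          ∀ k, k ≠ i → Int.gcd ((Ψ k).eval (fun _ => m)) (sieveModulus N) = 1),
        intVonMangoldt ((Ψ i).eval (fun _ => m))) - corrTerm ∅ Ψ K N := by
  classical
  rw [corrTerm_eq_sum_Icc {i} Ψ hI, corrTerm_eq_sum_Icc ∅ Ψ hI]
  simp only [Finset.prod_singleton, Finset.prod_empty, one_mul, Finset.sdiff_empty]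
  -- the product over `univ \ {i}`
  have hcard : (univ \ {i} : Finset (Fin t)).card = t - 1 := by
    rw [Finset.card_univ_sdiff, Fintype.card_fin, Finset.card_singleton]
  have hR : ∀ m ∈ Finset.Icc m₁ m₂, ∏ k ∈ univ \ {i}, sharpZ N ((Ψ k).eval (fun _ => m)) =
      if ∀ k, k ≠ i → Int.gcd ((Ψ k).eval (fun _ => m)) (sieveModulus N) = 1 then
        sieveWeight N ^ (t - 1) else 0 := by
    intro m hm
    rw [prod_sharpZ_eq (univ \ {i}) Ψ ((hI m).mp hm).2.2, hcard]
    have hiff : (∀ k ∈ (univ \ {i} : Finset (Fin t)),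
        Int.gcd ((Ψ k).eval (fun _ => m)) (sieveModulus N) = 1) ↔
        ∀ k, k ≠ i → Int.gcd ((Ψ k).eval (fun _ => m)) (sieveModulus N) = 1 := by
      simp only [Finset.mem_sdiff, Finset.mem_univ, Finset.mem_singleton, true_and]
    by_cases h : ∀ k, k ≠ i → Int.gcd ((Ψ k).eval (fun _ => m)) (sieveModulus N) = 1
    · rw [if_pos h, if_pos (hiff.mpr h)]
    · rw [if_neg h, if_neg (fun h' => h (hiff.mp h'))]
  -- the full product
  have hfull : ∀ m ∈ Finset.Icc m₁ m₂,
      sharpZ N ((Ψ i).eval (fun _ => m)) * ∏ k ∈ univ \ {i}, sharpZ N ((Ψ k).eval (fun _ => m)) =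
        ∏ k ∈ (univ : Finset (Fin t)), sharpZ N ((Ψ k).eval (fun _ => m)) := by
    intro m _
    rw [Finset.sdiff_singleton_eq_erase]
    exact Finset.mul_prod_erase (univ : Finset (Fin t))
      (fun k => sharpZ N ((Ψ k).eval (fun _ => m))) (Finset.mem_univ i)
  have hsplit : ∀ m ∈ Finset.Icc m₁ m₂,
      flatZ N ((Ψ i).eval (fun _ => m)) * ∏ k ∈ univ \ {i}, sharpZ N ((Ψ k).eval (fun _ => m)) =
        intVonMangoldt ((Ψ i).eval (fun _ => m)) *
            (if ∀ k, k ≠ i → Int.gcd ((Ψ k).eval (fun _ => m)) (sieveModulus N) = 1 then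
              sieveWeight N ^ (t - 1) else 0) -
          ∏ k ∈ (univ : Finset (Fin t)), sharpZ N ((Ψ k).eval (fun _ => m)) := by
    intro m hm
    rw [← hfull m hm, ← hR m hm]
    unfold flatZ
    ring
  rw [Finset.sum_congr rfl hsplit, Finset.sum_sub_distrib]
  congr 1
  rw [Finset.sum_filter, Finset.mul_sum]
  refine Finset.sum_congr rfl fun m _ => ?_
  split_ifs with h
  · ring
  · simp

/-! ## S♯ and S1 from the registered stubs -/

/-- **S♯ from `SieveCount` and `SingularTailAtLevel`**: `|C_∅ − β_∞ 𝔖| ≤ |(P/φ)^t # − #I ∏_{p≤y} β_p|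
+ #I |∏_{p≤y} β_p − 𝔖| + |#I − β_∞| 𝔖 ≤ εN`. [folklore] -/
theorem sharpMainTerm_of : SieveCount → SingularTailAtLevel → SharpMainTerm := by
  intro hA hB t L _ht ε hε
  obtain ⟨N₁, hN₁⟩ := hA t L (ε / 4) (by positivity)
  obtain ⟨N₂, hN₂⟩ := hB t L (ε / 8) (by positivity)
  refine ⟨max 1 (max N₁ N₂), fun N hN Ψ hΨ hL K hK hKN => ?_⟩
  have hN1 : 1 ≤ N := le_trans (le_max_left _ _) hN
  have hNN₁ : N₁ ≤ N := le_trans (le_trans (le_max_left _ _) (le_max_right _ _)) hN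
  have hNN₂ : N₂ ≤ N := le_trans (le_trans (le_max_right _ _) (le_max_right _ _)) hN
  have hNr : (1 : ℝ) ≤ N := by exact_mod_cast hN1
  obtain ⟨m₁, m₂, hI, hvol⟩ := exists_posInterval Ψ hK hKN
  have hpos : IsPosInterval Ψ N m₁ m₂ := isPosInterval_of_iff Ψ hI
  set X : ℝ := (#(Finset.Icc m₁ m₂) : ℝ) with hX
  set SP : ℝ := singularProductPartial Ψ ⌊roughLevel N⌋₊ with hSP
  have hXle : X ≤ 2 * N + 1 := card_Icc_le_of_isPosInterval Ψ hpos
  have hX0 : 0 ≤ X := Nat.cast_nonneg _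
  have h1 := hN₁ N hNN₁ Ψ hΨ hL m₁ m₂ hpos
  obtain ⟨h2, h3⟩ := hN₂ N hNN₂ Ψ hΨ hL
  have hSP0 : 0 ≤ SP := Finset.prod_nonneg fun p _ => localFactor_nonneg Ψ p
  have harch0 : 0 ≤ archFactor Ψ K := ENNReal.toReal_nonneg
  rw [corrTerm_empty_eq Ψ hI]
  -- the three pieces
  have hvol' : |X - archFactor Ψ K| ≤ 1 := hvol
  have e : sieveWeight N ^ t *
        (#((Finset.Icc m₁ m₂).filter (fun m : ℤ =>
            ∀ k, Int.gcd ((Ψ k).eval (fun _ => m)) (sieveModulus N) = 1)) : ℝ) -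
        archFactor Ψ K * singularProduct Ψ =
      (sieveWeight N ^ t *
          (#((Finset.Icc m₁ m₂).filter (fun m : ℤ =>
              ∀ k, Int.gcd ((Ψ k).eval (fun _ => m)) (sieveModulus N) = 1)) : ℝ) - X * SP) +
        X * (SP - singularProduct Ψ) + (X - archFactor Ψ K) * singularProduct Ψ := by ring
  rw [e]
  have hS : |singularProduct Ψ| ≤ SP + ε / 8 := by
    have := abs_sub_abs_le_abs_sub (singularProduct Ψ) SP
    rw [abs_sub_comm] at h2
    rw [abs_of_nonneg hSP0] at this
    linarith
  calc |sieveWeight N ^ t *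
            (#((Finset.Icc m₁ m₂).filter (fun m : ℤ =>
                ∀ k, Int.gcd ((Ψ k).eval (fun _ => m)) (sieveModulus N) = 1)) : ℝ) - X * SP +
          X * (SP - singularProduct Ψ) + (X - archFactor Ψ K) * singularProduct Ψ|
      ≤ |sieveWeight N ^ t *
            (#((Finset.Icc m₁ m₂).filter (fun m : ℤ =>
                ∀ k, Int.gcd ((Ψ k).eval (fun _ => m)) (sieveModulus N) = 1)) : ℝ) - X * SP| +
          |X * (SP - singularProduct Ψ)| + |(X - archFactor Ψ K) * singularProduct Ψ| :=
        abs_add_three _ _ _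
    _ ≤ ε / 4 * N + (2 * N + 1) * (ε / 8) + 1 * (SP + ε / 8) := by
        refine add_le_add_three h1 ?_ ?_
        · rw [abs_mul, abs_of_nonneg hX0]
          exact mul_le_mul hXle h2 (abs_nonneg _) (by positivity)
        · rw [abs_mul]
          exact mul_le_mul hvol' hS (abs_nonneg _) zero_le_one
    _ ≤ ε / 4 * N + (2 * N + 1) * (ε / 8) + (ε / 8 * N + ε / 8) := by linarith [h3]
    _ ≤ ε * N := by nlinarith [hε, hNr]

/-- **S1 from `SieveCount` and `PrimeSieveMain`**: `|C_{{i}}| ≤ |(P/φ)^{t−1} S_i − #I ∏ β_p|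
+ |(P/φ)^t #sifted − #I ∏ β_p| ≤ εN`. [folklore] -/
theorem oneFlatFactor_of : SieveCount → PrimeSieveMain → OneFlatFactor := by
  intro hA hC t L _ht ε hε
  obtain ⟨N₁, hN₁⟩ := hA t L (ε / 2) (by positivity)
  obtain ⟨N₂, hN₂⟩ := hC t L (ε / 2) (by positivity)
  refine ⟨max N₁ N₂, fun N hN Ψ hΨ hL K hK hKN i => ?_⟩
  have hNN₁ : N₁ ≤ N := le_trans (le_max_left _ _) hN
  have hNN₂ : N₂ ≤ N := le_trans (le_max_right _ _) hN
  obtain ⟨m₁, m₂, hI, -⟩ := exists_posInterval Ψ hK hKN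
  have hpos : IsPosInterval Ψ N m₁ m₂ := isPosInterval_of_iff Ψ hI
  have h1 := hN₁ N hNN₁ Ψ hΨ hL m₁ m₂ hpos
  have h2 := hN₂ N hNN₂ Ψ hΨ hL i m₁ m₂ hpos
  rw [corrTerm_singleton_eq Ψ hI i, corrTerm_empty_eq Ψ hI]
  rw [abs_sub_comm] at h1
  calc _ ≤ _ := abs_sub_le _ ((#(Finset.Icc m₁ m₂) : ℝ) * singularProductPartial Ψ ⌊roughLevel N⌋₊) _
    _ ≤ ε / 2 * N + ε / 2 * N := add_le_add h2 h1
    _ = ε * N := by ring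

end Summit.Parity.GeneralizedHardyLittlewood.Cruxes.DimOne.BirthSieve

end
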